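import Summits.MatrixMultiplication.MatrixMultiplication.Theorems.SaturationLadderLevelTwoKit7
import Literature.Computability.AlgebraicComplexity.BigCwSquareFormatValueMatrix
import HarnessLib

/-!
# Level 2 of the saturation ladder at `ω(1,5,1)` — the design (`d = 2059`, `q = 7`)
# (route `SaturationLadder`, node `TailDescentTwo`, lens 1, gen 22)

Cell `decomp-mm`, lens 1, gen 22, fourth rung of the level-2 defect ladder (the rung itself is
`SaturationLadderLevelTwoK5`: `ω(1,5,1) ≤ 401/65`).  No named facts, no sorry; the definitions are
the explicit design.  Same kernel and proof shape as `SaturationLadderLevelTwoK4Word`, but over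
`CW_7^{⊗2}`: at `q = 6` the format cap `A^5 ≤ B` pins the `3 : 3 : 2` family kernel below its
`k = 5` optimum (`ln B / ln A = 4.92` there), at `q = 7` it does not (generated by count and modulus
substitution, `gen22/gen_k5.py`; block lemmas `blockOf7 / blk7 / app7` from
`SaturationLadderLevelTwoKit7`).

THE WORD.  `lvl2Word` of length `2059 = 1331 + 8 · 91` over the level-2 support at `q = 7`: eleven
matrix letters as constant runs (counts `040:2, 004:2, 310:5, 130:9, 220:42, 301:5, 103:9, 202:42,
031:135, 013:135, 022:945`; NO letter `400`) followed by `91` repetitions of the 8-letter family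
word `cwSqFam332Word` (`BigCwSquarePieces`: the `3 : 3 : 2` block of `[112]_σ, [121]_σ, [211]''` at
`σ = 19/20`); block format value `(V; X, Y, X)`, `V = (2^6)^{91}`, `X = 14^{14} 51^{42} (7^5)^{91}`,
`Y = 14^{270} 51^{945} (7^{57/10})^{91}` (`hasFormatValue_lvl2Word`).

THE LAW.  `lvl2Law` is of product form `f(I) g(J) g(L)` on the fourteen used letters
(`f = (17745, 1183, 182, 5)/2059`, `g = (1, 1, 3/13, 9/1183, 2/17745)`; integrality
`2·n₁₃₀·n₀₂₂ = 3·n₂₂₀·n₀₃₁`: `2·9·945 = 3·42·135`), row `I = 4` has marginal zero, so the penalty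
over `cwSupport₂` is `0` (`maxEntropyPenalty_lvl2Law`); marginals
`x : (1219, 564, 266, 10, 0)/2059`, `y = z : (58, 595, 1260, 144, 2)/2059`.

## References

* F. Le Gall, *Faster algorithms for rectangular matrix multiplication*, FOCS 2012,
  arXiv:1204.1111, §3, §6.1, Prop. 6.2, Table 2. [LeGall2012]
* D. Coppersmith, S. Winograd, *Matrix multiplication via arithmetic progressions*,
  J. Symbolic Comput. 9 (1990), §8. [CoppersmithWinograd1990]
* D. Coppersmith, *Rectangular matrix multiplication revisited*, J. Complexity 13 (1997), §3.
  [Coppersmith1997]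
* F. Le Gall, *Powers of tensors and fast matrix multiplication*, ISSAC 2014, arXiv:1401.7714,
  Thm. 4.1 and Appendix A.3. [LeGall2014]
* F. Le Gall, F. Urrutia, *Improved rectangular matrix multiplication using powers of the
  Coppersmith–Winograd tensor*, SODA 2018, arXiv:1708.05622, Table 3. [LeGallUrrutia2018]
-/

set_option linter.dupNamespace false
set_option autoImplicit false
set_option exponentiation.threshold 100000
set_option maxRecDepth 100000

noncomputable section

open Finset Real
open scoped BigOperators

namespace Summit.MatrixMultiplication.MatrixMultiplication.Theorems.SaturationLadderLevelTwoK5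

open Literature.Computability.AlgebraicComplexity
open SaturationLadderLevelTwoKit (PL5 supp14 supp14_subset eq_400_of_not_mem_supp14
  maxEntropyPenalty_eq_of_row_zero)
open SaturationLadderLevelTwoKit7
open SaturationLadderLevelTwo (append_mem repWord_mem const_mem fin5_lits negMulLog_div'
  log_two_mul_shannonEntropy_fin5)

/-! ## The design -/

/-- **The matrix part of the design**: eleven matrix letters of `CW_7^{⊗2}` as constant runs with
counts `040:2, 004:2, 310:5, 130:9, 220:42, 301:5, 103:9, 202:42, 031:135, 013:135, 022:945`
(total `1331`). [folklore] -/
def matWord : Fin 1331 → PL5 :=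
  Fin.append (fun _ : Fin 2 => ((0 : Fin 5), (4 : Fin 5), (0 : Fin 5))) <|
  Fin.append (fun _ : Fin 2 => ((0 : Fin 5), (0 : Fin 5), (4 : Fin 5))) <|
  Fin.append (fun _ : Fin 5 => ((3 : Fin 5), (1 : Fin 5), (0 : Fin 5))) <|
  Fin.append (fun _ : Fin 9 => ((1 : Fin 5), (3 : Fin 5), (0 : Fin 5))) <|
  Fin.append (fun _ : Fin 42 => ((2 : Fin 5), (2 : Fin 5), (0 : Fin 5))) <|
  Fin.append (fun _ : Fin 5 => ((3 : Fin 5), (0 : Fin 5), (1 : Fin 5))) <|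
  Fin.append (fun _ : Fin 9 => ((1 : Fin 5), (0 : Fin 5), (3 : Fin 5))) <|
  Fin.append (fun _ : Fin 42 => ((2 : Fin 5), (0 : Fin 5), (2 : Fin 5))) <|
  Fin.append (fun _ : Fin 135 => ((0 : Fin 5), (3 : Fin 5), (1 : Fin 5))) <|
  Fin.append (fun _ : Fin 135 => ((0 : Fin 5), (1 : Fin 5), (3 : Fin 5)))
    (fun _ : Fin 945 => ((0 : Fin 5), (2 : Fin 5), (2 : Fin 5)))

/-- **The level-2 word for `ω(1,5,1)`** (`d = 2059`): the matrix part followed by `91`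
repetitions of the `3 : 3 : 2` family word. [folklore] -/
def lvl2Word : Fin 2059 → PL5 := Fin.append matWord (repWord cwSqFam332Word 91)

/-- The letters of the matrix part lie in the used support. [folklore] -/
theorem matWord_mem : ∀ ρ, matWord ρ ∈ supp14 := by
  have h := append_mem
    (const_mem (S := supp14) (a := ((0 : Fin 5), (4 : Fin 5), (0 : Fin 5))) (by decide) 2)
    (append_mem
    (const_mem (S := supp14) (a := ((0 : Fin 5), (0 : Fin 5), (4 : Fin 5))) (by decide) 2)
    (append_mem
    (const_mem (S := supp14) (a := ((3 : Fin 5), (1 : Fin 5), (0 : Fin 5))) (by decide) 5)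
    (append_mem
    (const_mem (S := supp14) (a := ((1 : Fin 5), (3 : Fin 5), (0 : Fin 5))) (by decide) 9)
    (append_mem
    (const_mem (S := supp14) (a := ((2 : Fin 5), (2 : Fin 5), (0 : Fin 5))) (by decide) 42)
    (append_mem
    (const_mem (S := supp14) (a := ((3 : Fin 5), (0 : Fin 5), (1 : Fin 5))) (by decide) 5)
    (append_mem
    (const_mem (S := supp14) (a := ((1 : Fin 5), (0 : Fin 5), (3 : Fin 5))) (by decide) 9)
    (append_mem
    (const_mem (S := supp14) (a := ((2 : Fin 5), (0 : Fin 5), (2 : Fin 5))) (by decide) 42)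
    (append_mem
    (const_mem (S := supp14) (a := ((0 : Fin 5), (3 : Fin 5), (1 : Fin 5))) (by decide) 135)
    (append_mem
    (const_mem (S := supp14) (a := ((0 : Fin 5), (1 : Fin 5), (3 : Fin 5))) (by decide) 135)
    ((const_mem (S := supp14) (a := ((0 : Fin 5), (2 : Fin 5), (2 : Fin 5))) (by decide)
      945)))))))))))
  exact h

/-- The letters of the family repetitions lie in the used support. [folklore] -/
theorem famRep_mem : ∀ ρ, repWord cwSqFam332Word 91 ρ ∈ supp14 := by
  refine repWord_mem (fun ρ => ?_) 91
  have h := cwSqFam332Word_mem ρ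
  simp only [Finset.mem_insert, Finset.mem_singleton] at h
  rcases h with h | h | h <;> rw [h] <;> decide

/-- The letters of the level-2 word lie in the used support. [folklore] -/
theorem lvl2Word_mem_supp14 : ∀ ρ, lvl2Word ρ ∈ supp14 := by
  unfold lvl2Word
  exact append_mem matWord_mem famRep_mem

/-- The letters of the level-2 word lie in the level-2 support. [folklore] -/
theorem lvl2Word_mem : ∀ ρ, lvl2Word ρ ∈ cwSupport₂ := fun ρ =>
  supp14_subset (lvl2Word_mem_supp14 ρ)

/-- **The letter counts of the level-2 word.** [folklore] -/
theorem letterCount_lvl2Word (s : PL5) : letterCount lvl2Word s =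
    (if s = (0, 4, 0) then 2 else 0) + ((if s = (0, 0, 4) then 2 else 0) +
    ((if s = (3, 1, 0) then 5 else 0) + ((if s = (1, 3, 0) then 9 else 0) +
    ((if s = (2, 2, 0) then 42 else 0) + ((if s = (3, 0, 1) then 5 else 0) +
    ((if s = (1, 0, 3) then 9 else 0) + ((if s = (2, 0, 2) then 42 else 0) +
    ((if s = (0, 3, 1) then 135 else 0) + ((if s = (0, 1, 3) then 135 else 0) +
    (if s = (0, 2, 2) then 945 else 0)))))))))) +
    91 * ((if s = (1, 1, 2) then 3 else 0) + (if s = (1, 2, 1) then 3 else 0) +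
      (if s = (2, 1, 1) then 2 else 0)) := by
  simp only [lvl2Word, matWord, letterCount_append, Pi.add_apply, letterCount_const,
    letterCount_repWord, letterCount_cwSqFam332Word]

/-! ## The block value of the word -/

/-- **The matrix part is worth `(1; 14^14·51^42, 14^270·51^945, 14^14·51^42)`** (products of
the eleven matrix format values `(1; cwSqFmtA, cwSqFmtB, cwSqFmtC)` at `q = 7`: `2q = 14`,
`q²+2 = 51`). [cite: LeGall2012, §3 and §6.1] [cite: CoppersmithWinograd1990, §8] -/
theorem hasFormatValue_matWord : HasFormatValue (blockOf7 matWord) 1 ((14 : ℝ) ^ 14 * 51 ^ 42)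
    ((14 : ℝ) ^ 270 * 51 ^ 945) ((14 : ℝ) ^ 14 * 51 ^ 42) := by
  have h040 : HasFormatValue (cwSqComp ℂ 7 0 4 0) 1 1 1 1 := hasFormatValue_cwSqComp040 ℂ 7
  have h004 : HasFormatValue (cwSqComp ℂ 7 0 0 4) 1 1 1 1 := hasFormatValue_cwSqComp004 ℂ 7
  have h310 : HasFormatValue (cwSqComp ℂ 7 3 1 0) 1 14 1 1 := by
    have h := hasFormatValue_cwSqComp310 ℂ 7; norm_num at h; exact h
  have h130 : HasFormatValue (cwSqComp ℂ 7 1 3 0) 1 14 1 1 := by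
    have h := hasFormatValue_cwSqComp130 ℂ 7; norm_num at h; exact h
  have h220 : HasFormatValue (cwSqComp ℂ 7 2 2 0) 1 51 1 1 := by
    have h := hasFormatValue_cwSqComp220 ℂ 7; norm_num at h; exact h
  have h301 : HasFormatValue (cwSqComp ℂ 7 3 0 1) 1 1 1 14 := by
    have h := hasFormatValue_cwSqComp301 ℂ 7; norm_num at h; exact h
  have h103 : HasFormatValue (cwSqComp ℂ 7 1 0 3) 1 1 1 14 := by
    have h := hasFormatValue_cwSqComp103 ℂ 7; norm_num at h; exact h
  have h202 : HasFormatValue (cwSqComp ℂ 7 2 0 2) 1 1 1 51 := by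
    have h := hasFormatValue_cwSqComp202 ℂ 7; norm_num at h; exact h
  have h031 : HasFormatValue (cwSqComp ℂ 7 0 3 1) 1 1 14 1 := by
    have h := hasFormatValue_cwSqComp031 ℂ 7; norm_num at h; exact h
  have h013 : HasFormatValue (cwSqComp ℂ 7 0 1 3) 1 1 14 1 := by
    have h := hasFormatValue_cwSqComp013 ℂ 7; norm_num at h; exact h
  have h022 : HasFormatValue (cwSqComp ℂ 7 0 2 2) 1 1 51 1 := by
    have h := hasFormatValue_cwSqComp022 ℂ 7; norm_num at h; exact h
  have h := app7 (blk7 (0, 4, 0) 2 h040) <| app7 (blk7 (0, 0, 4) 2 h004) <|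
    app7 (blk7 (3, 1, 0) 5 h310) <| app7 (blk7 (1, 3, 0) 9 h130) <|
    app7 (blk7 (2, 2, 0) 42 h220) <| app7 (blk7 (3, 0, 1) 5 h301) <|
    app7 (blk7 (1, 0, 3) 9 h103) <| app7 (blk7 (2, 0, 2) 42 h202) <|
    app7 (blk7 (0, 3, 1) 135 h031) <| app7 (blk7 (0, 1, 3) 135 h013) (blk7 (0, 2, 2) 945 h022)
  unfold matWord
  convert h using 1 <;> (simp only [one_pow, one_mul, mul_one]; ring)

/-- **The family repetitions are worth `((2^6)^{91}; (7^5)^{91}, (7^{57/10})^{91},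
(7^5)^{91})`** (the `3 : 3 : 2` block at `σ = 19/20`, repeated). [cite: LeGall2012, Prop. 6.2] -/
theorem hasFormatValue_famRep :
    HasFormatValue (blockOf7 (repWord cwSqFam332Word 91)) (((2 : ℝ) ^ (6 : ℝ)) ^ 91)
      (((7 : ℝ) ^ (5 : ℝ)) ^ 91) (((7 : ℝ) ^ ((57 : ℝ) / 10)) ^ 91)
      (((7 : ℝ) ^ (5 : ℝ)) ^ 91) := by
  have h := hasFormatValue_laserBlock_cwSqFam332Word ℂ 7 (by norm_num)
  have h6 : (0 : ℝ) ≤ (7 : ℕ) := by norm_num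
  have h' := h.laserBlock_repWord cwLev2 cwLev2 cwLev2 (bigCwSq ℂ 7) (by positivity)
    (Real.rpow_nonneg h6 _) (Real.rpow_nonneg h6 _) (Real.rpow_nonneg h6 _) 91
  simpa using h'

/-- The total `x`- (and `z`-) format of the word. [folklore] -/
def Xtot : ℝ := (14 : ℝ) ^ 14 * 51 ^ 42 * (((7 : ℝ) ^ (5 : ℝ)) ^ 91)

/-- The total `y`-format of the word. [folklore] -/
def Ytot : ℝ := (14 : ℝ) ^ 270 * 51 ^ 945 * (((7 : ℝ) ^ ((57 : ℝ) / 10)) ^ 91)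

/-- The total value of the word. [folklore] -/
def Vtot : ℝ := 1 * ((2 : ℝ) ^ (6 : ℝ)) ^ 91

/-- `X > 0`. [folklore] -/
theorem Xtot_pos : 0 < Xtot := by unfold Xtot; positivity

/-- `Y > 0`. [folklore] -/
theorem Ytot_pos : 0 < Ytot := by unfold Ytot; positivity

/-- `V > 0`. [folklore] -/
theorem Vtot_pos : 0 < Vtot := by unfold Vtot; positivity

/-- **The block value of the level-2 word**: `(V; X, Y, X)`.
[cite: LeGall2012, §6.1 and Prop. 6.2] -/
theorem hasFormatValue_lvl2Word : HasFormatValue (blockOf7 lvl2Word) Vtot Xtot Ytot Xtot := by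
  unfold lvl2Word Vtot Xtot Ytot
  have h6 : (0 : ℝ) ≤ 7 := by norm_num
  exact hasFormatValue_matWord.laserBlock_append cwLev2 cwLev2 cwLev2 (bigCwSq ℂ 7)
    hasFormatValue_famRep zero_le_one (by positivity) (by positivity)
    (pow_nonneg (Real.rpow_nonneg h6 _) _) (by positivity) (pow_nonneg (Real.rpow_nonneg h6 _) _)
    (by positivity) (pow_nonneg (Real.rpow_nonneg h6 _) _)

/-! ## The law of the word: product form on the used support -/

/-- **The law of the word** (its type divided by its length). [folklore] -/
def lvl2Law (s : PL5) : ℝ := (letterCount lvl2Word s : ℝ) / 2059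

/-- The law, with the length as a cast natural. [folklore] -/
theorem lvl2Law_eq (s : PL5) :
    lvl2Law s = (letterCount lvl2Word s : ℝ) / ((2059 : ℕ) : ℝ) := by
  rw [lvl2Law]; simp only [Nat.cast_ofNat]

/-- The law vanishes off the used support. [folklore] -/
theorem lvl2Law_eq_zero' (s : PL5) (hs : s ∉ supp14) : lvl2Law s = 0 := by
  rw [lvl2Law, letterCount_eq_zero_of_forall_mem lvl2Word_mem_supp14 s hs]; simp

/-- The law vanishes off the level-2 support. [folklore] -/
theorem lvl2Law_eq_zero (s : PL5) (hs : s ∉ cwSupport₂) : lvl2Law s = 0 :=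
  lvl2Law_eq_zero' s fun h => hs (supp14_subset h)

/-- The law is nonnegative. [folklore] -/
theorem lvl2Law_nonneg (s : PL5) : 0 ≤ lvl2Law s := by unfold lvl2Law; positivity

/-- The law sums to one. [folklore] -/
theorem sum_lvl2Law : ∑ s, lvl2Law s = 1 := by
  show ∑ s, (letterCount lvl2Word s : ℝ) / 2059 = 1
  rw [← Finset.sum_div, ← Nat.cast_sum, sum_letterCount lvl2Word]
  norm_num

/-- The law is a probability vector. [folklore] -/
theorem lvl2Law_mem_stdSimplex : lvl2Law ∈ stdSimplex ℝ PL5 := ⟨lvl2Law_nonneg, sum_lvl2Law⟩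

/-- The `x`-factor of the product form of the counts (divided by the length; the value at the
unused row `I = 4` is immaterial). [folklore] -/
def fX (i : Fin 5) : ℝ :=
  (if i = 0 then 17745 else if i = 1 then 1183 else if i = 2 then 182 else 5) / 2059

/-- The `y`- and `z`-factor of the product form of the counts. [folklore] -/
def gY (j : Fin 5) : ℝ :=
  if j = 0 then 1 else if j = 1 then 1 else if j = 2 then 3 / 13 else if j = 3 then 9 / 1183
    else 2 / 17745

/-- The `x`-factor is positive. [folklore] -/
theorem fX_pos (i : Fin 5) : 0 < fX i := by unfold fX; split_ifs <;> norm_num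

/-- The `y`-factor is positive. [folklore] -/
theorem gY_pos (j : Fin 5) : 0 < gY j := by unfold gY; split_ifs <;> norm_num

/-- **The law is of product form on the used support**: `n_{IJL} = f(I) g(J) g(L)`. [folklore] -/
theorem lvl2Law_prod : ∀ x ∈ supp14, lvl2Law x = fX x.1 * gY x.2.1 * gY x.2.2 := by
  intro x hx
  simp only [supp14, Finset.mem_insert, Finset.mem_singleton] at hx
  rcases hx with rfl | rfl | rfl | rfl | rfl | rfl | rfl | rfl | rfl | rfl | rfl | rfl | rfl | rfl
  all_goals norm_num [lvl2Law, letterCount_lvl2Word, fX, gY, fin5_lits]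

/-! ## Marginals and penalty zero -/

/-- The `x`-marginal: `(1219, 564, 266, 10, 0)/2059`. [folklore] -/
theorem marginalDist₁_lvl2Law :
    marginalDist₁ lvl2Law 0 = 1219 / 2059 ∧ marginalDist₁ lvl2Law 1 = 564 / 2059 ∧
      marginalDist₁ lvl2Law 2 = 266 / 2059 ∧ marginalDist₁ lvl2Law 3 = 10 / 2059 ∧
      marginalDist₁ lvl2Law 4 = 0 := by
  simp only [marginalDist₁_eq_sum_filter supp14 lvl2Law_eq_zero', supp14]
  refine ⟨?_, ?_, ?_, ?_, ?_⟩ <;>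
    norm_num [Finset.filter_insert, Finset.filter_singleton, lvl2Law, letterCount_lvl2Word,
      fin5_lits]

/-- The `y`-marginal: `(58, 595, 1260, 144, 2)/2059`. [folklore] -/
theorem marginalDist₂_lvl2Law :
    marginalDist₂ lvl2Law 0 = 58 / 2059 ∧ marginalDist₂ lvl2Law 1 = 595 / 2059 ∧
      marginalDist₂ lvl2Law 2 = 1260 / 2059 ∧ marginalDist₂ lvl2Law 3 = 144 / 2059 ∧
      marginalDist₂ lvl2Law 4 = 2 / 2059 := by
  simp only [marginalDist₂_eq_sum_filter supp14 lvl2Law_eq_zero', supp14]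
  refine ⟨?_, ?_, ?_, ?_, ?_⟩ <;>
    norm_num [Finset.filter_insert, Finset.filter_singleton, lvl2Law, letterCount_lvl2Word,
      fin5_lits]

/-- The `z`-marginal: `(58, 595, 1260, 144, 2)/2059`. [folklore] -/
theorem marginalDist₃_lvl2Law :
    marginalDist₃ lvl2Law 0 = 58 / 2059 ∧ marginalDist₃ lvl2Law 1 = 595 / 2059 ∧
      marginalDist₃ lvl2Law 2 = 1260 / 2059 ∧ marginalDist₃ lvl2Law 3 = 144 / 2059 ∧
      marginalDist₃ lvl2Law 4 = 2 / 2059 := by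
  simp only [marginalDist₃_eq_sum_filter supp14 lvl2Law_eq_zero', supp14]
  refine ⟨?_, ?_, ?_, ?_, ?_⟩ <;>
    norm_num [Finset.filter_insert, Finset.filter_singleton, lvl2Law, letterCount_lvl2Word,
      fin5_lits]

/-- **Penalty zero**: `Γ_{cwSupport₂}(P) = Γ_{supp14}(P) = 0` for the law of the word (row `I = 4`
has marginal zero; product form on the used support).
[cite: LeGall2012, §6.1] [cite: CoppersmithWinograd1990, §8] -/
theorem maxEntropyPenalty_lvl2Law : maxEntropyPenalty cwSupport₂ lvl2Law = 0 := by
  rw [maxEntropyPenalty_eq_of_row_zero supp14_subset (fun x hx hx' => by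
    rw [eq_400_of_not_mem_supp14 x hx hx']; exact marginalDist₁_lvl2Law.2.2.2.2)]
  exact maxEntropyPenalty_eq_zero_of_mul supp14 lvl2Law_mem_stdSimplex lvl2Law_eq_zero' fX gY gY
    (fun x _ => fX_pos x.1) (fun x _ => gY_pos x.2.1) (fun x _ => gY_pos x.2.2) lvl2Law_prod

end Summit.MatrixMultiplication.MatrixMultiplication.Theorems.SaturationLadderLevelTwoK5

end
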